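import Summits.NavierStokesRegularity.NavierStokesRegularity.Theorems.TypeILiouvilleTypeIliouvilleNoTypeIIStubActiveWindowsExtraction
import Summits.NavierStokesRegularity.NavierStokesRegularity.Theorems.TypeILiouvilleTypeIliouvilleNoTypeIIStubActiveWindowsZoom
import HarnessLib

/-!
# Stub `stub_activeWindowsGenerateNonconstant` of the line `Sketch` (immortal zoom)
# (crux `TypeIliouvilleNoTypeII`, stmt-NavierStokesRegularity-0056, route `TypeILiouville`)

**Active windows generate a non-constant bounded eternal mild solution** (the two-sided, Type-II
twin of the tree's singular Type-I zoom; Koch–Nadirashvili–Seregin–Šverák 2009, Lemma 6.1 / §4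
compactness, run on two-sided windows). Let `(u, p)` be a classical solution of Navier–Stokes on
`ℝ³ × [0, T)`, Leray–Hopf from a rapidly decaying datum, `ε > 0`, and suppose that for every
`k : ℕ` there are a time `t`, a level `M > 0` and a point `x₀` such that the window
`[t - kν/M², t + kν/M²] ⊂ (0, T)` is sup-controlled (`‖u‖ ≤ M` on it) and its centre is
gradient-active (`ε M² ≤ ν ‖∇u(t, x₀)‖`). Then the window zooms
`w_k(s, y) = M⁻¹ u(t + sν/M², x₀ + yν/M)` (`TypeILiouvilleTypeIliouvilleNoTypeIIStubActiveWindowsZoom`: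
unit-viscosity classical solutions on `(-k, k)`, Oseen-mild there, `|w_k| ≤ 1`,
`‖∇w_k(0, 0)‖ ≥ ε`) subconverge with their gradients at every point
(`exists_tendsto_of_bounded_seq`, `TypeILiouvilleTypeIliouvilleNoTypeIIStubActiveWindowsExtraction`)
to a bounded ETERNAL Oseen-mild smooth divergence-free field `v` on `ℝ × ℝ³` with `‖v‖ ≤ 1` and
`ε ≤ ‖∇v(0, 0)‖`.
-/

noncomputable section

-- the summit and its single problem share the name (D-0017 nested layout)
set_option linter.dupNamespace false

open MeasureTheory Set Function Filter TopologicalSpace Metric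
open scoped Topology NNReal ENNReal

namespace Summit.NavierStokesRegularity.NavierStokesRegularity.Theorems.TypeIliouvilleNoTypeII.ImmortalZoom

open Literature.Analysis Literature.Analysis.FluidPDE
open Summit.NavierStokesRegularity.NavierStokesRegularity.Theorems

/-- `ℝ³`. -/
local notation "E3" => EuclideanSpace ℝ (Fin 3)

/-- **STUB 3 of the line `Sketch` (active windows generate a non-constant bounded eternal mild
solution).** See the module docstring. [cite: KochNadirashviliSereginSverak2009, Lemma 6.1 and Prop. 4.1 (arXiv:0709.3599 pp. 8, 11)] -/
theorem stub_activeWindowsGenerateNonconstant (ν T : ℝ) (hν : 0 < ν) (hT : 0 < T)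
    (u : ℝ → E3 → E3) (p : ℝ → E3 → ℝ) (hsol : IsClassicalNSSolutionOn (Ico 0 T) ν 0 u p)
    (hLH : IsLerayHopfOn T ν 0 (u 0) u) (hdec : HasRapidSpatialDecay (u 0)) (ε : ℝ) (hε : 0 < ε)
    (hwin : ∀ k : ℕ, ∃ t M : ℝ, ∃ x₀ : E3, 0 < M ∧
      Icc (t - k * ν / M ^ 2) (t + k * ν / M ^ 2) ⊆ Ioo 0 T ∧
      (∀ s ∈ Icc (t - k * ν / M ^ 2) (t + k * ν / M ^ 2), ∀ x, ‖u s x‖ ≤ M) ∧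
      ε * M ^ 2 ≤ ν * ‖fderiv ℝ (u t) x₀‖) :
    ∃ v : ℝ → E3 → E3, ContDiff ℝ (⊤ : ℕ∞) (uncurry v) ∧
      (∀ t, VectorCalculus.IsDivFree (v t)) ∧
      (∀ s t : ℝ, s < t → ∀ x, v t x = heatFlow (v s) (t - s) x - oseenDuhamel 1 s v v t x) ∧
      (∀ t x, ‖v t x‖ ≤ 1) ∧ ε ≤ ‖fderiv ℝ (v 0) 0‖ := by
  have _hε := hε
  choose tc M xc hM hsub hbd hact using hwin
  -- the window zooms
  set w : ℕ → ℝ → E3 → E3 := fun k => (M k)⁻¹ • stPull (ν / M k ^ 2) (ν / M k) (tc k) (xc k) u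
    with hw
  have hA : Tendsto (fun k : ℕ => -(k : ℝ)) atTop atBot :=
    tendsto_neg_atTop_atBot.comp tendsto_natCast_atTop_atTop
  have hB : Tendsto (fun k : ℕ => (k : ℝ)) atTop atTop := tendsto_natCast_atTop_atTop
  have hc : ∀ k : ℕ, ContinuousOn (uncurry (w k)) (Ioo (-(k : ℝ)) k ×ˢ univ) := fun k =>
    windowZoom_continuousOn hν hsol (hM k) (hsub k)
  have hdivw : ∀ k : ℕ, ∀ t ∈ Ioo (-(k : ℝ)) k, IsWeaklyDivFree (w k t) := fun k t ht =>
    windowZoom_isWeaklyDivFree hν hsol (hM k) (hsub k) ht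
  have hmild : ∀ k : ℕ, ∀ s t : ℝ, -(k : ℝ) < s → s < t → t < k → ∀ x,
      w k t x = UnboundedOperators.heatExtension (w k s) (t - s) x -
        oseenDuhamel 1 s (w k) (w k) t x := by
    intro k s t hs hst ht x
    have hsI : s ∈ Ioo (-(k : ℝ)) k := ⟨hs, hst.trans ht⟩
    have htI : t ∈ Ioo (-(k : ℝ)) k := ⟨hs.trans hst, ht⟩
    exact windowZoom_oseen hν hT hsol hLH hdec (hM k) (windowZoom_time_mem hν (hM k) (hsub k) hsI).1
      hst (windowZoom_time_mem hν (hM k) (hsub k) htI).2 x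
  have hbdw : ∀ k : ℕ, ∀ t ∈ Ioo (-(k : ℝ)) k, ∀ x, ‖w k t x‖ ≤ 1 := fun k t ht x =>
    windowZoom_norm_le_one hν (hM k) (hbd k) ht x
  -- the extraction
  obtain ⟨φ, hφ, W, hWs, hWdiv, hWmild, hWbd, -, hgrad⟩ :=
    exists_tendsto_of_bounded_seq 1 hA hB hc hdivw hmild hbdw
  refine ⟨W, hWs, hWdiv, hWmild, hWbd, ?_⟩
  -- the active centre survives: `ε ≤ ‖∇w_k(0, 0)‖` for every `k`, hence in the limit
  have hk : ∀ k, ε ≤ ‖fderiv ℝ (w k 0) 0‖ := fun k => by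
    have htI : tc k ∈ Ico 0 T := by
      have h0 : tc k ∈ Icc (tc k - k * ν / M k ^ 2) (tc k + k * ν / M k ^ 2) := by
        have : 0 ≤ (k : ℝ) * ν / M k ^ 2 := by
          have := hM k; positivity
        exact ⟨by linarith, by linarith⟩
      exact Ioo_subset_Ico_self (hsub k h0)
    exact le_norm_fderiv_windowZoom_zero hν (hM k)
      ((hsol.contDiff_velocity htI).differentiable (by simp)) (hact k)
  exact ge_of_tendsto (hgrad 0 0).norm (Eventually.of_forall fun j => hk (φ j))

end Summit.NavierStokesRegularity.NavierStokesRegularity.Theorems.TypeIliouvilleNoTypeII.ImmortalZoom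

end
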